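import Mathlib.Algebra.Group.End
import Mathlib.GroupTheory.Perm.Cycle.Type
import Literature.Combinatorics.Additive.TripleProductProperty
import Summits.MatrixMultiplication.MatrixMultiplication.Theorems.SnSubsetDichotomyThresholdSubsetTriplesChainDefs

/-!
# `SnSubsetDichotomy.ThresholdSubsetTriples` — stub `stub_designRuleR1` (cross-level design rule R1)

Crux `stmt-MatrixMultiplication-10882` (`ThresholdSubsetTriples`), line `interleaved-subsignature-ascent`,
census c3b §3: the simplest CROSS-LEVEL obstruction to the triple product property of three top-extended
classes `(starPiece E₁ N * L₁, starPiece E₂ N * L₂, starPiece E₃ N * L₃)` at the token `N`.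

If the lower quotient set `L₁ L₁⁻¹` contains the 3-cycle `x ↦ y ↦ z ↦ x` (written `a a'⁻¹ = swap x z * swap x y`),
the first class uses the direction `x` at `N` and the second class uses BOTH directions `y, z` at `N`, then the
triple product property fails.  Witness: `s = swap(x,N) a`, `s' = swap(x,N) a'`, `t = swap(y,N) b`,
`t' = swap(z,N) b`, `u = u' = swap(e,N) c`.

Proof, Mathlib API route: `s s'⁻¹` is the conjugate `MulAut.conj (swap x N) (a a'⁻¹)`, and conjugating a
transposition is `Equiv.swap_apply_apply` (`f * swap p q * f⁻¹ = swap (f p) (f q)`), so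
`s s'⁻¹ = swap N z * swap N y`; `t t'⁻¹ = swap y N * swap z N` cancels it (`Equiv.swap_mul_self_mul`).  The
triple product property then forces `s = s'`, i.e. `a a'⁻¹ = 1`, contradicting that `swap x z * swap x y` is a
3-cycle (`Equiv.Perm.isThreeCycle_swap_mul_swap_same`, `IsCycle.ne_one`).
-/

-- `Summit.<Summit>.<Problem>` is the tree's mandated summit-side namespace; for this single-conjunct summit the
-- two components coincide, so the file silences `dupNamespace` (same as the vocabulary file it imports).
set_option linter.dupNamespace false
set_option autoImplicit false

-- Siege attempt k5 proves the registered stub under its registered short name; the lead's copy already owns the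
-- fully-qualified name `…Theorems.ThresholdSubsetTriples.stub_designRuleR1`, so this file lives one namespace below.
namespace Summit.MatrixMultiplication.MatrixMultiplication.Theorems.ThresholdSubsetTriples.DesignRuleR1K5

open scoped Pointwise
open Literature.Combinatorics.Additive

/-- Conjugating the 3-cycle `swap x z * swap x y` (`x ↦ y ↦ z ↦ x`) by the star letter `swap x N` replaces `x`
by `N`: the result is `swap N z * swap N y` (`N ↦ y ↦ z ↦ N`), provided `y, z ∉ {x, N}`.  Pure Mathlib:
`MulAut.conj` is a homomorphism and `Equiv.swap_apply_apply` conjugates each transposition. -/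
theorem conj_swap_threeCycle {α : Type*} [DecidableEq α] (N x y z : α) (hxy : x ≠ y) (hxz : x ≠ z)
    (hyN : y ≠ N) (hzN : z ≠ N) :
    MulAut.conj (Equiv.swap x N) (Equiv.swap x z * Equiv.swap x y) = Equiv.swap N z * Equiv.swap N y := by
  have e1 : Equiv.swap x N x = N := Equiv.swap_apply_left x N
  have e2 : Equiv.swap x N z = z := Equiv.swap_apply_of_ne_of_ne hxz.symm hzN
  have e3 : Equiv.swap x N y = y := Equiv.swap_apply_of_ne_of_ne hxy.symm hyN
  rw [map_mul, MulAut.conj_apply, MulAut.conj_apply, ← Equiv.swap_apply_apply, ← Equiv.swap_apply_apply,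
    e1, e2, e3]

/-- **Design rule R1 (stub `stub_designRuleR1`, census c3b §3).**  Token `N`; lower sets `L₁ ∋ a, a'` with
`a a'⁻¹` the 3-cycle `x ↦ y ↦ z ↦ x` (`= swap x z * swap x y`), `L₂ ∋ b`, `L₃ ∋ c`; directions `x ∈ E₁`,
`y, z ∈ E₂` and some `e ∈ E₃`; `x, y, z` distinct and `y, z ≠ N`.  Then the top-extended triple
`(starPiece E₁ N * L₁, starPiece E₂ N * L₂, starPiece E₃ N * L₃)` does NOT have the triple product property. -/
theorem stub_designRuleR1 {α : Type*} [DecidableEq α] [Fintype α] (N x y z e : α) (E₁ E₂ E₃ : Finset α) (L₁ L₂ L₃ : Finset (Equiv.Perm α)) (a a' b c : Equiv.Perm α) (ha : a ∈ L₁) (ha' : a' ∈ L₁) (hb : b ∈ L₂) (hc : c ∈ L₃) (hq : a * a'⁻¹ = Equiv.swap x z * Equiv.swap x y) (hx : x ∈ E₁) (hy : y ∈ E₂) (hz : z ∈ E₂) (he : e ∈ E₃) (hxy : x ≠ y) (hxz : x ≠ z) (hyz : y ≠ z) (hyN : y ≠ N) (hzN : z ≠ N) : ¬ TripleProductProperty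 (starPiece E₁ N * L₁) (starPiece E₂ N * L₂) (starPiece E₃ N * L₃) := by
  intro hT
  -- the lower quotient `a a'⁻¹` is a 3-cycle, hence not the identity
  have h3 : a * a'⁻¹ ≠ 1 :=
    hq ▸ (Equiv.Perm.isThreeCycle_swap_mul_swap_same hxz hxy hyz.symm).isCycle.ne_one
  -- the witnesses lie in the three top-extended classes
  have hs : Equiv.swap x N * a ∈ starPiece E₁ N * L₁ :=
    Finset.mul_mem_mul (mem_starPiece.2 ⟨x, hx, rfl⟩) ha
  have hs' : Equiv.swap x N * a' ∈ starPiece E₁ N * L₁ :=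
    Finset.mul_mem_mul (mem_starPiece.2 ⟨x, hx, rfl⟩) ha'
  have ht : Equiv.swap y N * b ∈ starPiece E₂ N * L₂ :=
    Finset.mul_mem_mul (mem_starPiece.2 ⟨y, hy, rfl⟩) hb
  have ht' : Equiv.swap z N * b ∈ starPiece E₂ N * L₂ :=
    Finset.mul_mem_mul (mem_starPiece.2 ⟨z, hz, rfl⟩) hb
  have hu : Equiv.swap e N * c ∈ starPiece E₃ N * L₃ :=
    Finset.mul_mem_mul (mem_starPiece.2 ⟨e, he, rfl⟩) hc
  -- first quotient: a conjugate of the 3-cycle by the star letter `swap x N`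
  have hss : Equiv.swap x N * a * (Equiv.swap x N * a')⁻¹ = Equiv.swap N z * Equiv.swap N y := by
    rw [← conj_swap_threeCycle N x y z hxy hxz hyN hzN, ← hq]
    simp only [MulAut.conj_apply, mul_inv_rev, Equiv.swap_inv, mul_assoc]
  -- second quotient: the lower letter `b` cancels
  have htt : Equiv.swap y N * b * (Equiv.swap z N * b)⁻¹ = Equiv.swap N y * Equiv.swap N z := by
    rw [mul_inv_rev, Equiv.swap_inv, ← mul_assoc, mul_inv_cancel_right, Equiv.swap_comm y N,
      Equiv.swap_comm z N]
  -- the TPP relation of the witness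
  have hrel : Equiv.swap x N * a * (Equiv.swap x N * a')⁻¹ *
      (Equiv.swap y N * b * (Equiv.swap z N * b)⁻¹) *
      (Equiv.swap e N * c * (Equiv.swap e N * c)⁻¹) = 1 := by
    rw [hss, htt, mul_inv_cancel, mul_one, mul_assoc, Equiv.swap_mul_self_mul, Equiv.swap_mul_self]
  -- the triple product property forces `s = s'`, i.e. `a = a'`, so the 3-cycle would be trivial
  obtain ⟨hss', -, -⟩ := hT _ hs _ hs' _ ht _ ht' _ hu _ hu hrel
  exact h3 (by rw [mul_left_cancel hss', mul_inv_cancel])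

end Summit.MatrixMultiplication.MatrixMultiplication.Theorems.ThresholdSubsetTriples.DesignRuleR1K5
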